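import Summits.PneNP.PneNP.Theorems.ExpanderLinearGeneratorsColumnTwoFinal

/-!
# PneNP / ExpanderLinearGenerators — transfer of bounded-depth refutations onto an `ℓ`-sparse
XOR-system: polynomial size bookkeeping

Route `PneNP/ExpanderLinearGenerators`, support for crux stmt-PneNP-11443
(`LinearGeneratorDepthFregeHard`). GIRS's transfer lemma
(`TextbookFrege.transfer_isDepthProofOf`) moves a depth-`d` `textbookFrege` refutation of a CNF
`T` along a substitution `σ` to a depth-`(d + 16)` refutation of a CNF `T'`, provided every
substituted clause of `T` is implied by few clauses of `T'` on few variables. This file packages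
the case used by the calibration theorems of this session: `σ` substitutes variables or
constants (size `1`, no depth), and `T' = sumEncoding 1 E'` for an `ℓ`-sparse system `E'`, each
substituted source clause being implied by ONE equation of `E'` (all its `≤ 2^ℓ` clauses, on its
`≤ ℓ` variables).

* `transferBound_poly` — the size bound of the transfer is a polynomial (cubic) in
  `Z = S + msum T'`, with a constant depending on `(qq, k)` only;
* `msum_sumEncoding_le` — `msum` of the rendered XOR-CNF of an `ℓ`-sparse system with `m` rows is
  `≤ m · 2^ℓ (3ℓ + 2)`;
* `length_le_proofSize_of_refutes` — a refutation of `T` is at least as long as `T`;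
* `exists_xorProof_of_rowLocal` — the packaged transfer;
* `lb_of_poly`, `eventually_lb_params` — the closing arithmetic (`2^{n^ε} ≤ poly(S)` forces
  `2^{n^{ε/2}} ≤ S` for large `n`).

References: N. Galesi, D. Itsykson, A. Riazanov, A. Sofronova, APAL 174 (2023), Lemma 10.
-/

namespace Summit.PneNP.PneNP.Theorems.LinGen

open Filter Finset Literature.Computability.MetaComplexity
open Literature.Computability.MetaComplexity.TextbookFrege
open Literature.Computability.Complexity (PropForm Clause CNF Literal)
open Literature.Computability.Complexity.PropForm
open Literature.Computability.MetaComplexity.KrajicekRamsey (clauseOf ofCNF_eq_conjList)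
open Summit.PneNP.PneNP.Theorems.GridRouting Summit.PneNP.PneNP.Theorems.ColumnTwo

variable {m n : ℕ}

/-! ### The transfer bound is a cubic polynomial -/

/-- **The transfer is polynomial.** For fixed `(qq, k)` there is a constant `C` with
`transferLines S Z qq k · (40 ((qq+3)(Z+3) + k) + 300) ≤ C · (Z + 3)³` whenever `S ≤ Z`.
[folklore] -/
theorem transferBound_poly (qq k : ℕ) : ∃ Cst : ℕ, 0 < Cst ∧ ∀ S Z : ℕ, S ≤ Z →
    transferLines S Z qq k * (40 * ((qq + 3) * (Z + 3) + k) + 300) ≤ Cst * (Z + 3) ^ 3 := by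
  obtain ⟨N, hN⟩ : ∃ N : ℕ, N = k + qq + 1 := ⟨_, rfl⟩
  obtain ⟨A, hA⟩ : ∃ A : ℕ, A = 2 ^ N * ((qq + 1) * (100 * (N + 8) ^ 2) + (50 * (2 * N + 3) ^ 2 + 2)) +
    50 * (qq + 4) ^ 2 + qq * (130 + 50 * (qq + 4) ^ 2 + 8) := ⟨_, rfl⟩
  obtain ⟨B, hB⟩ : ∃ B : ℕ, B = 40 * (qq + 3) + 40 * k + 300 := ⟨_, rfl⟩
  refine ⟨(A + 308) * B, Nat.mul_pos (by omega) (by omega), fun S Z hSZ => ?_⟩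
  obtain ⟨Y, hY⟩ : ∃ Y : ℕ, Y = Z + 3 := ⟨_, rfl⟩
  have hY3 : 3 ≤ Y := by omega
  have hY1 : 1 ≤ Y := by omega
  -- the tautology tables
  have h1 : tautLines N ((qq + 1) * (Z + 2)) ≤
      2 ^ N * ((qq + 1) * (100 * (N + 8) ^ 2) + (50 * (2 * N + 3) ^ 2 + 2)) * Y := by
    unfold tautLines
    have e1 : (qq + 1) * (Z + 2) * (100 * (N + 8) ^ 2) ≤ (qq + 1) * (100 * (N + 8) ^ 2) * Y := by
      have : Z + 2 ≤ Y := by omega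
      calc (qq + 1) * (Z + 2) * (100 * (N + 8) ^ 2)
          = (qq + 1) * (100 * (N + 8) ^ 2) * (Z + 2) := by ring
        _ ≤ (qq + 1) * (100 * (N + 8) ^ 2) * Y := Nat.mul_le_mul_left _ this
    have e2 : 50 * (2 * N + 3) ^ 2 + 2 ≤ (50 * (2 * N + 3) ^ 2 + 2) * Y :=
      Nat.le_mul_of_pos_right _ hY1
    calc 2 ^ N * ((qq + 1) * (Z + 2) * (100 * (N + 8) ^ 2) + 50 * (2 * N + 3) ^ 2 + 2)
        ≤ 2 ^ N * ((qq + 1) * (100 * (N + 8) ^ 2) * Y + (50 * (2 * N + 3) ^ 2 + 2) * Y) :=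
          Nat.mul_le_mul_left _ (by omega)
      _ = _ := by ring
  -- one clause
  have h2 : transferClauseLines Z qq k ≤ A * Y := by
    unfold transferClauseLines
    have e3 : 50 * (qq + 4) ^ 2 ≤ 50 * (qq + 4) ^ 2 * Y := Nat.le_mul_of_pos_right _ hY1
    have e4 : qq * (130 * (Z + 3) + 50 * (qq + 4) ^ 2 + 8) ≤ qq * (130 + 50 * (qq + 4) ^ 2 + 8) * Y := by
      rw [Nat.mul_assoc]
      refine Nat.mul_le_mul_left _ ?_
      have : 50 * (qq + 4) ^ 2 + 8 ≤ (50 * (qq + 4) ^ 2 + 8) * Y := Nat.le_mul_of_pos_right _ hY1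
      rw [← hY]; nlinarith
    rw [← hN]
    calc tautLines N ((qq + 1) * (Z + 2)) + 50 * (qq + 4) ^ 2 +
          qq * (130 * (Z + 3) + 50 * (qq + 4) ^ 2 + 8)
        ≤ 2 ^ N * ((qq + 1) * (100 * (N + 8) ^ 2) + (50 * (2 * N + 3) ^ 2 + 2)) * Y +
          50 * (qq + 4) ^ 2 * Y + qq * (130 + 50 * (qq + 4) ^ 2 + 8) * Y :=
          Nat.add_le_add (Nat.add_le_add h1 e3) e4
      _ = A * Y := by rw [hA]; ring
  -- all lines
  have h3 : transferLines S Z qq k ≤ (A + 308) * Y ^ 2 := by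
    unfold transferLines
    have e5 : Z * (transferClauseLines Z qq k + 51) ≤ Y * (A * Y + 51) :=
      Nat.mul_le_mul (by omega) (by omega)
    have e6 : Y ≤ Y ^ 2 := by nlinarith
    have e7 : 2300 ≤ 256 * Y ^ 2 := by nlinarith
    have e8 : S ≤ Y := by omega
    calc S + Z * (transferClauseLines Z qq k + 51) + 2300 ≤ Y + Y * (A * Y + 51) + 2300 := by omega
      _ = A * Y ^ 2 + 52 * Y + 2300 := by ring
      _ ≤ A * Y ^ 2 + 52 * Y ^ 2 + 256 * Y ^ 2 := by omega
      _ = (A + 308) * Y ^ 2 := by ring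
  -- the width factor
  have h4 : 40 * ((qq + 3) * (Z + 3) + k) + 300 ≤ B * Y := by
    rw [hB]
    have : 40 * k + 300 ≤ (40 * k + 300) * Y := Nat.le_mul_of_pos_right _ hY1
    nlinarith
  calc transferLines S Z qq k * (40 * ((qq + 3) * (Z + 3) + k) + 300)
      ≤ (A + 308) * Y ^ 2 * (B * Y) := Nat.mul_le_mul h3 h4
    _ = (A + 308) * B * (Z + 3) ^ 3 := by rw [hY]; ring

/-! ### Sizes of rendered XOR-CNFs -/

/-- `msum` of the rendered clauses of a concatenation is bounded block by block. [folklore] -/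
theorem msum_flatMap_le {ι : Type*} (L : List ι) (f : ι → CNF ℕ) (B : ℕ)
    (h : ∀ i ∈ L, msum ((f i).map clauseOf) ≤ B) :
    msum ((L.flatMap f).map clauseOf) ≤ L.length * B := by
  induction L with
  | nil => simp
  | cons a L ih =>
    rw [List.flatMap_cons, List.map_append, msum_append, List.length_cons]
    have h1 := h a List.mem_cons_self
    have h2 := ih fun i hi => h i (List.mem_cons_of_mem _ hi)
    nlinarith

/-- `msum` of the rendered clauses of one equation of an `ℓ`-sparse system (`B = 1`):
at most `2^ℓ` clauses of size `≤ 3ℓ + 1`. [folklore] -/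
theorem msum_equationCNF_le {ℓ : ℕ} (e : LinEqMod 2 n) (h : e.supp.card ≤ ℓ) :
    msum ((equationCNF 1 e).map clauseOf) ≤ 2 ^ ℓ * (3 * ℓ + 2) := by
  have hcl : ∀ X ∈ (equationCNF 1 e).map clauseOf, X.size + 1 ≤ 3 * ℓ + 2 := by
    intro X hX
    obtain ⟨c, hc, rfl⟩ := List.mem_map.1 hX
    have h1 := OntoPHPReduction.size_clauseOf_le c
    have h2 : c.length = e.supp.card := by
      rw [equationCNF] at hc
      rw [length_of_mem_canonicalCNF hc, length_eqVars, mul_one]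
    omega
  refine (msum_le_length_mul hcl).trans ?_
  rw [List.length_map]
  exact Nat.mul_le_mul_right _
    ((length_equationCNF_le e).trans (Nat.pow_le_pow_right (by norm_num) h))

/-- **`msum` of the rendered XOR-CNF of an `ℓ`-sparse system** with `m` rows is at most
`m · 2^ℓ (3ℓ + 2)`. [folklore] -/
theorem msum_sumEncoding_le {ℓ : ℕ} (E : Fin m → LinEqMod 2 n) (h : ∀ i, (E i).supp.card ≤ ℓ) :
    msum ((sumEncoding 1 E).map clauseOf) ≤ m * (2 ^ ℓ * (3 * ℓ + 2)) := by
  unfold sumEncoding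
  have := msum_flatMap_le (List.finRange m) (fun k => equationCNF 1 (E k)) (2 ^ ℓ * (3 * ℓ + 2))
    fun i _ => msum_equationCNF_le (E i) (h i)
  rwa [List.length_finRange] at this

/-- **A refutation of a CNF is at least as long as the CNF** (the last line alone displays every
clause). [folklore] -/
theorem length_le_proofSize_of_refutes {d : ℕ} {π : List (PropForm ℕ)} {T : CNF ℕ}
    (hπ : textbookFrege.IsDepthProofOf d π (neg (PropForm.ofCNF T))) : T.length ≤ proofSize π := by
  have h1 := size_le_proofSize_of_isDepthProofOf hπ
  rw [size, ofCNF_eq_conjList, size_conjList_eq_msum] at h1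
  have h2 := length_le_msum (T.map clauseOf)
  rw [List.length_map] at h2
  omega

/-! ### The packaged transfer onto an XOR-system -/

/-- **Transfer onto an `ℓ`-sparse XOR-system.** Let `π` be a depth-`d` `textbookFrege`
refutation of a CNF `T`, `σ` a substitution by formulas of size `1` and auxiliary depth `0`
(variables and constants), and `E'` an `ℓ`-sparse system over `𝔽₂` such that every substituted
clause of `T` has its variables among those of some equation `E' i` and is true whenever `E' i`
holds. Then `¬ ofCNF (sumEncoding 1 E')` has a depth-`(d + 16)` refutation of size at most the
GIRS transfer bound at `Z = S + m · 2^ℓ (3ℓ+2)`, `qq = 2^ℓ`, `k = ℓ` (`S = proofSize π`).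
[Galesi–Itsykson–Riazanov–Sofronova 2023, Lemma 10] [folklore] -/
theorem exists_xorProof_of_rowLocal {d ℓ : ℕ} {π : List (PropForm ℕ)} (T : CNF ℕ)
    (E' : Fin m → LinEqMod 2 n) (σ : ℕ → PropForm ℕ)
    (hZ : ∀ x, (σ x).size ≤ 1) (hT : ∀ x c, altDepthAux c (σ x) ≤ 0)
    (hℓ : ∀ i, (E' i).supp.card ≤ ℓ)
    (hπ : textbookFrege.IsDepthProofOf d π (neg (PropForm.ofCNF T)))
    (hloc : ∀ c ∈ T, ∃ i, (∀ x ∈ ((clauseOf c).subst σ).vars, x ∈ eqVars 1 (E' i)) ∧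
      ∀ τ : ℕ → Bool, (E' i).Holds (blockVals 2 1 n τ) → ((clauseOf c).subst σ).eval τ = true) :
    ∃ π', textbookFrege.IsDepthProofOf (d + 16) π' (neg (PropForm.ofCNF (sumEncoding 1 E'))) ∧
      proofSize π' ≤ transferLines (proofSize π) (proofSize π + m * (2 ^ ℓ * (3 * ℓ + 2))) (2 ^ ℓ) ℓ *
        (40 * ((2 ^ ℓ + 3) * (proofSize π + m * (2 ^ ℓ * (3 * ℓ + 2)) + 3) + ℓ) + 300) := by
  set T' := sumEncoding 1 E' with hT'
  have htr := transfer_isDepthProofOf T T' σ (Zσ := 1) (Tσ := 0) (qq := 2 ^ ℓ) (k := ℓ) hZ le_rfl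
    hT hπ ?_
  · obtain ⟨π', hπ', hsize⟩ := htr
    refine ⟨π', by simpa using hπ', hsize.trans ?_⟩
    have hm : proofSize π * 1 + msum (T'.map clauseOf) ≤ proofSize π + m * (2 ^ ℓ * (3 * ℓ + 2)) := by
      rw [Nat.mul_one]
      exact Nat.add_le_add_left (msum_sumEncoding_le E' hℓ) _
    have h2 := Nat.mul_le_mul_left (2 ^ ℓ + 3) (Nat.add_le_add_right hm 3)
    exact Nat.mul_le_mul (transferLines_mono le_rfl hm) (by omega)
  -- the local implications
  intro c hc
  obtain ⟨i, hvars, himp⟩ := hloc c hc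
  refine ⟨equationCNF 1 (E' i), eqVars 1 (E' i), ?_, ?_, nodup_eqVars 1 _, ?_, hvars, ?_, ?_⟩
  · intro K hK
    simp only [hT', sumEncoding, List.mem_flatMap, List.mem_finRange, true_and]
    exact ⟨i, hK⟩
  · exact (length_equationCNF_le (E' i)).trans (Nat.pow_le_pow_right (by norm_num) (hℓ i))
  · rw [length_eqVars, mul_one]
    exact hℓ i
  · intro K hK x hx
    obtain ⟨l, hl, rfl⟩ := exists_literal_of_mem_vars_clauseOf hx
    exact fst_mem_of_mem_canonicalCNF hK hl
  · intro τ hτ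
    refine himp τ ?_
    have hall := eval_equationCNF 1 (E' i) τ
    have hev : (equationCNF 1 (E' i)).eval τ = true := by
      rw [CNF.eval_eq_true_iff]
      intro K hK
      have := hτ K hK
      rwa [OntoPHPReduction.eval_clauseOf] at this
    rw [hev] at hall
    exact of_decide_eq_true hall.symm

/-! ### Closing arithmetic -/

/-- **From a polynomial transfer to the exponent `ε/2`.** If `2^{n^ε} ≤ S' ≤ T (a S + b + 3)³`
with `b + 3 ≤ X`, `T (a+1)³ ≤ X` and `4 n^{ε'} < n^ε`, where `X = 2^{n^{ε'}}`, then `X ≤ S`.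
[folklore] -/
theorem lb_of_poly {ε ε' : ℝ} {n S S' T a b : ℕ}
    (hlb : (2 : ℝ) ^ ((n : ℝ) ^ ε) ≤ S') (hsz : S' ≤ T * (a * S + b + 3) ^ 3)
    (hb : (b : ℝ) + 3 ≤ (2 : ℝ) ^ ((n : ℝ) ^ ε'))
    (hT : (T : ℝ) * ((a : ℝ) + 1) ^ 3 ≤ (2 : ℝ) ^ ((n : ℝ) ^ ε'))
    (h4 : 4 * (n : ℝ) ^ ε' < (n : ℝ) ^ ε) :
    (2 : ℝ) ^ ((n : ℝ) ^ ε') ≤ S := by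
  by_contra hlt
  push Not at hlt
  set X : ℝ := (2 : ℝ) ^ ((n : ℝ) ^ ε') with hX
  have hX0 : 0 < X := by positivity
  have ha0 : (0 : ℝ) ≤ a := Nat.cast_nonneg a
  have hT0 : (0 : ℝ) ≤ T := Nat.cast_nonneg T
  have h1 : ((a * S + b + 3 : ℕ) : ℝ) ≤ ((a : ℝ) + 1) * X := by
    push_cast
    nlinarith
  have h1' : (0 : ℝ) ≤ ((a * S + b + 3 : ℕ) : ℝ) := Nat.cast_nonneg _
  have h2 : (S' : ℝ) ≤ X ^ 4 :=
    calc (S' : ℝ) ≤ T * ((a * S + b + 3 : ℕ) : ℝ) ^ 3 := by exact_mod_cast hsz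
      _ ≤ T * (((a : ℝ) + 1) * X) ^ 3 :=
          mul_le_mul_of_nonneg_left (pow_le_pow_left₀ h1' h1 3) hT0
      _ = (T * ((a : ℝ) + 1) ^ 3) * X ^ 3 := by ring
      _ ≤ X * X ^ 3 := mul_le_mul_of_nonneg_right hT (by positivity)
      _ = X ^ 4 := by ring
  have h3 : (2 : ℝ) ^ ((n : ℝ) ^ ε) ≤ (2 : ℝ) ^ (4 * (n : ℝ) ^ ε') := by
    calc (2 : ℝ) ^ ((n : ℝ) ^ ε) ≤ (S' : ℝ) := hlb
      _ ≤ X ^ 4 := h2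
      _ = (2 : ℝ) ^ (4 * (n : ℝ) ^ ε') := by
          rw [hX, ← Real.rpow_natCast, ← Real.rpow_mul (by norm_num), mul_comm]
          norm_num
  have h5 : (n : ℝ) ^ ε ≤ 4 * (n : ℝ) ^ ε' := (Real.rpow_le_rpow_left_iff one_lt_two).1 h3
  linarith

/-- **The eventual inequalities** used with `lb_of_poly` at `ε' = ε/2`: for every constant
`c`, eventually `c n + 3 ≤ 2^{n^{ε/2}}`, `c ≤ 2^{n^{ε/2}}`, `4 n^{ε/2} < n^ε` and `1 ≤ n`.
[folklore] -/
theorem eventually_lb_params (c : ℕ) {ε : ℝ} (hε : 0 < ε) :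
    ∀ᶠ n : ℕ in atTop, (c : ℝ) * n + 3 ≤ (2 : ℝ) ^ ((n : ℝ) ^ (ε / 2)) ∧
      (c : ℝ) ≤ (2 : ℝ) ^ ((n : ℝ) ^ (ε / 2)) ∧ 4 * (n : ℝ) ^ (ε / 2) < (n : ℝ) ^ ε ∧ 1 ≤ n := by
  have hε2 : 0 < ε / 2 := by positivity
  have h2 := Literature.Computability.Complexity.eventually_pow_lt_two_rpow_rpow 2 hε2
  have hT : Tendsto (fun n : ℕ => (n : ℝ) ^ (ε / 2)) atTop atTop :=
    (tendsto_rpow_atTop hε2).comp tendsto_natCast_atTop_atTop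
  filter_upwards [h2, hT.eventually_gt_atTop 4, eventually_ge_atTop (c + 3)] with n hn h4 hge
  have hn1 : (c + 3 : ℝ) ≤ n := by exact_mod_cast hge
  have hn0 : (0 : ℝ) ≤ n := Nat.cast_nonneg n
  have hc0 : (0 : ℝ) ≤ c := Nat.cast_nonneg c
  have hsq : (n : ℝ) ^ 2 < (2 : ℝ) ^ ((n : ℝ) ^ (ε / 2)) := by simpa using hn
  refine ⟨by nlinarith, by nlinarith, ?_, by omega⟩
  have hp : 0 < (n : ℝ) ^ (ε / 2) := by
    have : (4 : ℝ) < (n : ℝ) ^ (ε / 2) := h4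
    linarith
  have e : (n : ℝ) ^ ε = (n : ℝ) ^ (ε / 2) * (n : ℝ) ^ (ε / 2) := by
    rw [← Real.rpow_add_of_nonneg hn0 hε2.le hε2.le]; ring_nf
  rw [e]
  exact mul_lt_mul_of_pos_right h4 hp

end Summit.PneNP.PneNP.Theorems.LinGen
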